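import Mathlib

/-!
# Ridge-leverage envelope and Nyström budget (DEQ-A10)

HONEST FRAMING: instance-level adjudication of specific advantage claims; no claim about
BQP vs BPP or the summit.

Context (cell pub-qadeq, claim A-10 = Yamasaki, Subramanian, Sonoda, Koashi,
arXiv:2004.10756v2 = NeurIPS 2020, "Learning with optimized random features: exponential
speedup by quantum machine learning without sparsity and low-rank assumptions", Theorem 1).
DEQ-A10.md (unit pub-qadeq-deq-1) shows that the paper's discretised optimized-random-feature
distribution is a ridge-leverage-score distribution `ℓ_v = t P(v) ⟨e_v|(A+ε)⁻¹|e_v⟩` with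
UNIT vectors `e_v`, whence the envelope `ℓ_v ≤ t P(v)/ε` and a classical rejection sampler
(NYS-ORF) whose Nyström surrogate needs `r ≥ t²(t+ε)²/(δ Δ² ε⁴)` landmarks.  The operator
statements are NOT formalised here; this file proves, sorry-free, the scalar spectral facts
they reduce to (apply them on an eigenbasis) and the budget arithmetic:

* `fEps_sub`, `abs_fEps_sub_le`: for `f_ε(x) = x/(x+ε)`,
  `f_ε a − f_ε b = ε (a−b)/((a+ε)(b+ε))` and `|f_ε a − f_ε b| ≤ |a−b|/ε` on `[0,∞)` —
  the operator-Lipschitz step of DEQ-A10 Lemma 3;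
* `inv_eq_one_sub_fEps_div`, `fEps_le_div`: `(x+ε)⁻¹ = (1 − f_ε x)/ε` and
  `0 ≤ f_ε x ≤ min 1 (x/ε)` — the envelope of Lemma 2;
* `tv_normalisation`: `½ Σ |aᵢ/Σa − bᵢ/Σb| ≤ (Σ|aᵢ−bᵢ|)/Σa` for non-negative families
  (DEQ-A10 §3.5);
* `tv_chain`, `landmark_budget`, `hoeffding_budget`: the three lines of arithmetic that turn
  `‖R†R − A‖ ≤ Δε²/(t+ε)` into `TV ≤ Δ`, Markov into `r ≥ t²(t+ε)²/(δΔ²ε⁴)`, and a union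
  bound over `K` characteristic-function values into `n_s ≥ 4 log(4K/δ')/η²`.

Everything is `[folklore]`-level real analysis / arithmetic; no named fact, no axiom.
-/

namespace Literature.Computability.QuantumAlgorithms.RidgeLeverageEnvelope

open Finset BigOperators

/-- `[folklore]` the spectral function of ridge leverage: `f_ε(x) = x/(x+ε)` -/
noncomputable def fEps (ε x : ℝ) : ℝ := x / (x + ε)

/-- `[folklore]` resolvent difference: `f_ε a − f_ε b = ε(a−b)/((a+ε)(b+ε))` -/
theorem fEps_sub {ε a b : ℝ} (hε : 0 < ε) (ha : 0 ≤ a) (hb : 0 ≤ b) :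
    fEps ε a - fEps ε b = ε * (a - b) / ((a + ε) * (b + ε)) := by
  unfold fEps
  have h1 : a + ε ≠ 0 := by positivity
  have h2 : b + ε ≠ 0 := by positivity
  field_simp
  ring

/-- `[folklore]` `0 ≤ f_ε x` for `x ≥ 0` -/
theorem fEps_nonneg {ε x : ℝ} (hε : 0 < ε) (hx : 0 ≤ x) : 0 ≤ fEps ε x := by
  unfold fEps; positivity

/-- `[folklore]` `f_ε x ≤ 1` for `x ≥ 0` -/
theorem fEps_le_one {ε x : ℝ} (hε : 0 < ε) (hx : 0 ≤ x) : fEps ε x ≤ 1 := by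
  unfold fEps
  rw [div_le_one (by positivity)]
  linarith

/-- `[folklore]` the envelope: `f_ε x ≤ x/ε` for `x ≥ 0` (DEQ-A10 Lemma 2) -/
theorem fEps_le_div {ε x : ℝ} (hε : 0 < ε) (hx : 0 ≤ x) : fEps ε x ≤ x / ε := by
  unfold fEps
  exact div_le_div_of_nonneg_left hx hε (by linarith)

/-- `[folklore]` resolvent identity: `(x+ε)⁻¹ = (1 − f_ε x)/ε`, i.e. `ℓ = (tP − h)/ε` in DEQ-A10 Lemma 1(d) -/
theorem inv_eq_one_sub_fEps_div {ε x : ℝ} (hε : 0 < ε) (hx : 0 ≤ x) :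
    (x + ε)⁻¹ = (1 - fEps ε x) / ε := by
  unfold fEps
  have h1 : x + ε ≠ 0 := by positivity
  field_simp
  ring

/-- `[folklore]` operator-Lipschitz constant of `f_ε` on `[0,∞)`: `|f_ε a − f_ε b| ≤ |a−b|/ε` -/
theorem abs_fEps_sub_le {ε a b : ℝ} (hε : 0 < ε) (ha : 0 ≤ a) (hb : 0 ≤ b) :
    |fEps ε a - fEps ε b| ≤ |a - b| / ε := by
  rw [fEps_sub hε ha hb, abs_div, abs_mul, abs_of_pos hε]
  have hprod : ε * ε ≤ (a + ε) * (b + ε) := by nlinarith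
  have hpos : 0 < (a + ε) * (b + ε) := by positivity
  rw [abs_of_pos hpos, div_le_div_iff₀ hpos hε]
  calc ε * |a - b| * ε = |a - b| * (ε * ε) := by ring
    _ ≤ |a - b| * ((a + ε) * (b + ε)) := by
        exact mul_le_mul_of_nonneg_left hprod (abs_nonneg _)

/-- `[folklore]` normalisation (DEQ-A10 §3.5): for non-negative families with positive sums,
`½ Σ |aᵢ/Σa − bᵢ/Σb| ≤ (Σ |aᵢ − bᵢ|)/Σa`. -/
theorem tv_normalisation {ι : Type*} (s : Finset ι) (a b : ι → ℝ)
    (hb : ∀ i ∈ s, 0 ≤ b i)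
    (hSa : 0 < ∑ i ∈ s, a i) (hSb : 0 < ∑ i ∈ s, b i) :
    (1 / 2) * ∑ i ∈ s, |a i / (∑ j ∈ s, a j) - b i / (∑ j ∈ s, b j)|
      ≤ (∑ i ∈ s, |a i - b i|) / (∑ j ∈ s, a j) := by
  set Sa := ∑ j ∈ s, a j with hSa_def
  set Sb := ∑ j ∈ s, b j with hSb_def
  set L := ∑ i ∈ s, |a i - b i| with hL_def
  -- termwise triangle inequality
  have hterm : ∀ i ∈ s, |a i / Sa - b i / Sb| ≤ |a i - b i| / Sa + b i * |1 / Sa - 1 / Sb| := by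
    intro i hi
    have : a i / Sa - b i / Sb = (a i - b i) / Sa + b i * (1 / Sa - 1 / Sb) := by ring
    rw [this]
    calc |(a i - b i) / Sa + b i * (1 / Sa - 1 / Sb)|
        ≤ |(a i - b i) / Sa| + |b i * (1 / Sa - 1 / Sb)| := abs_add_le _ _
      _ = |a i - b i| / Sa + b i * |1 / Sa - 1 / Sb| := by
          rw [abs_div, abs_of_pos hSa, abs_mul, abs_of_nonneg (hb i hi)]
  have hsum : ∑ i ∈ s, |a i / Sa - b i / Sb| ≤ L / Sa + Sb * |1 / Sa - 1 / Sb| := by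
    calc ∑ i ∈ s, |a i / Sa - b i / Sb|
        ≤ ∑ i ∈ s, (|a i - b i| / Sa + b i * |1 / Sa - 1 / Sb|) := Finset.sum_le_sum hterm
      _ = L / Sa + Sb * |1 / Sa - 1 / Sb| := by
          rw [Finset.sum_add_distrib, ← Finset.sum_div, ← Finset.sum_mul]
  -- |Sb - Sa| ≤ L
  have hdiff : |Sb - Sa| ≤ L := by
    have : Sb - Sa = ∑ i ∈ s, (b i - a i) := by
      rw [Finset.sum_sub_distrib]
    rw [this]
    calc |∑ i ∈ s, (b i - a i)| ≤ ∑ i ∈ s, |b i - a i| := Finset.abs_sum_le_sum_abs _ _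
      _ = L := by
          rw [hL_def]; exact Finset.sum_congr rfl (fun i _ => abs_sub_comm _ _)
  have hmid : Sb * |1 / Sa - 1 / Sb| = |Sb - Sa| / Sa := by
    have : 1 / Sa - 1 / Sb = (Sb - Sa) / (Sa * Sb) := by
      field_simp
    rw [this, abs_div, abs_of_pos (mul_pos hSa hSb)]
    field_simp
  rw [hmid] at hsum
  have h2 : ∑ i ∈ s, |a i / Sa - b i / Sb| ≤ 2 * (L / Sa) := by
    calc ∑ i ∈ s, |a i / Sa - b i / Sb| ≤ L / Sa + |Sb - Sa| / Sa := hsum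
      _ ≤ L / Sa + L / Sa := by
          gcongr
      _ = 2 * (L / Sa) := by ring
  linarith

/-- `[folklore]` the TV chain of DEQ-A10 Theorem A10: `L ≤ (t/ε²)·X`, `X ≤ Δε²/(t+ε)`, `S ≥ t/(t+ε)`
give `L/S ≤ Δ`. -/
theorem tv_chain {t ε Δ S L X : ℝ} (ht : 0 < t) (hε : 0 < ε) (hΔ : 0 ≤ Δ)
    (hS : t / (t + ε) ≤ S) (hL : L ≤ t / ε ^ 2 * X) (hX : X ≤ Δ * ε ^ 2 / (t + ε)) :
    L / S ≤ Δ := by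
  have hS0 : 0 < S := lt_of_lt_of_le (by positivity) hS
  rw [div_le_iff₀ hS0]
  have h1 : L ≤ t / ε ^ 2 * (Δ * ε ^ 2 / (t + ε)) :=
    hL.trans (mul_le_mul_of_nonneg_left hX (by positivity))
  have h2 : t / ε ^ 2 * (Δ * ε ^ 2 / (t + ε)) = Δ * (t / (t + ε)) := by
    field_simp
  rw [h2] at h1
  exact h1.trans (mul_le_mul_of_nonneg_left hS hΔ)

/-- `[folklore]` landmark budget (Markov step of DEQ-A10 Theorem A10):
`r ≥ t²(t+ε)²/(δΔ²ε⁴)` gives `t²/(r θ²) ≤ δ` for `θ = Δε²/(t+ε)`. -/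
theorem landmark_budget {t ε Δ δ r : ℝ} (ht : 0 < t) (hε : 0 < ε) (hΔ : 0 < Δ) (hδ : 0 < δ)
    (hr : t ^ 2 * (t + ε) ^ 2 / (δ * Δ ^ 2 * ε ^ 4) ≤ r) :
    t ^ 2 / (r * (Δ * ε ^ 2 / (t + ε)) ^ 2) ≤ δ := by
  have hr0 : 0 < r := lt_of_lt_of_le (by positivity) hr
  have hθ : 0 < (Δ * ε ^ 2 / (t + ε)) ^ 2 := by positivity
  rw [div_le_iff₀ (mul_pos hr0 hθ)]
  rw [div_le_iff₀ (by positivity)] at hr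
  have : δ * (r * (Δ * ε ^ 2 / (t + ε)) ^ 2) = r * (δ * Δ ^ 2 * ε ^ 4) / (t + ε) ^ 2 := by
    field_simp
  rw [this, le_div_iff₀ (by positivity)]
  exact hr

/-- `[folklore]` Hoeffding/union-bound budget (DEQ-A10 Corollary A10′):
`n ≥ 4 log(4K/δ')/η²` gives `4K·exp(−nη²/4) ≤ δ'`. -/
theorem hoeffding_budget {K δ' η n : ℝ} (hK : 0 < K) (hδ : 0 < δ') (hη : 0 < η)
    (hn : 4 * Real.log (4 * K / δ') / η ^ 2 ≤ n) :
    4 * K * Real.exp (-(n * η ^ 2 / 4)) ≤ δ' := by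
  have hlog : Real.log (4 * K / δ') ≤ n * η ^ 2 / 4 := by
    rw [div_le_iff₀ (by positivity)] at hn
    linarith
  have hexp : Real.exp (-(n * η ^ 2 / 4)) ≤ (4 * K / δ')⁻¹ := by
    have := Real.exp_le_exp.mpr (show -(n * η ^ 2 / 4) ≤ -Real.log (4 * K / δ') by linarith)
    rwa [Real.exp_neg (Real.log (4 * K / δ')), Real.exp_log (by positivity)] at this
  calc 4 * K * Real.exp (-(n * η ^ 2 / 4)) ≤ 4 * K * (4 * K / δ')⁻¹ :=
        mul_le_mul_of_nonneg_left hexp (by positivity)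
    _ = δ' := by field_simp

end Literature.Computability.QuantumAlgorithms.RidgeLeverageEnvelope
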